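import Mathlib.Analysis.Complex.Basic
import Mathlib.Algebra.Category.ModuleCat.Basic
import Literature.AlgebraicGeometry.Motives.Varieties
import Literature.AlgebraicGeometry.Motives.AlgPoints
import Literature.AlgebraicGeometry.Motives.Cycles
import Literature.AlgebraicGeometry.Motives.HodgeStructure
import Literature.AlgebraicGeometry.Motives.PreWeilCohomology
import Literature.AlgebraicGeometry.Motives.WeilCohomology
import Literature.AlgebraicTopology.SingularHomology.SingularCochains
import Literature.AlgebraicTopology.SingularHomology.CupProduct
import HarnessLib

-- provenance: harness21/H21/H21/Prelude/MotiveAbstract/BettiRealization.lean @ f1218b6 (interim HEAD d8f2665); M5 mechanical rewrite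
/-!
# Betti cohomology and the Betti–Hodge realization data (trunk MotiveAbstract, prelude C13)

For a scheme `X` over a subfield `k ⊆ ℂ` (any `k : Type` with `[Field k] [Algebra k ℂ]`), the
**Betti cohomology** `Hⁱ_B(X) := Hⁱ(X(ℂ); ℚ)` is the singular cohomology with rational
coefficients of the complex points `Literature.ComplexPoints X` with their analytic (strong) topology
(Serre, *GAGA* (1956), §2; Deligne, *Théorie de Hodge II* (1971), §3; Kleiman, *Algebraic cycles
and the Weil conjectures* (1968), §1.2, Example (1)). It is built from the accepted G04 singular
cohomology `Literature.singularCohomology ℚ ℚ` and its cup product `Literature.AlgebraicTopology.SingularHomology.cupProduct`; the topological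
functoriality is `Literature.AlgebraicGeometry.Motives.AlgPoints.mapContinuous`.

The **coniveau filtration** `Nʳ Hⁱ_B(X)` (Grothendieck, *Hodge's general conjecture is false for
trivial reasons*, Topology 8 (1969)) is the subspace of classes vanishing on `(X ∖ Z)(ℂ)` for some
Zariski-closed `Z ⊆ X` of codimension `≥ r`; it is a real definition (`Literature.AlgebraicGeometry.Motives.coniveau`).

That `Hⁱ_B(X)` of a smooth projective `X` underlies a Weil cohomology theory carrying polarizable
pure Hodge structures of weight `i`, functorial for pull-backs, with algebraic cycle classes of
type `(p, p)`, is deep mathematics (Hodge decomposition, comparison with de Rham cohomology,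
construction of trace and cycle class: Voisin, *Hodge Theory and Complex Algebraic Geometry I*,
Ch. 6–7 and §11.3; Deligne, Hodge II, §3). Following the outline (§1(f), §4.1) it enters H21 as a
**hypothesis structure** `Literature.BettiHodgeData k`: a `WeilCohomology k ℚ` together with a natural
isomorphism to `bettiFunctor`, compatible with cup products and units, and Hodge structures on
each `Hⁱ(X)` with the properties the Hodge-type conjectures consume. Against it we state, as
`Prop`-valued definitions only, the Hodge conjecture `BettiHodgeData.HodgeConjectureFor` and
Grothendieck's generalized Hodge conjecture `BettiHodgeData.GeneralizedHodgeConjectureFor`.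

## Main definitions

* `Literature.bettiCohomology X i := singularCohomology ℚ ℚ (ComplexPoints X) i`,
  `Literature.bettiCohomology.map f i` (pull-back along a `k`-morphism), `Literature.bettiFunctor k i`.
* `Literature.bettiCup h`, `Literature.bettiOne X`: the cup product and unit, i.e. G04's `cupProduct` and
  `singularCohomology.one` on `X(ℂ)`; `bettiCup_map`, `bettiCup_gradedComm`, `bettiCup_assoc`,
  `one_bettiCup`, `bettiCup_one`, `bettiCohomology.map_one`.
* `Literature.coniveau X i r : Submodule ℚ (bettiCohomology X i)`; `coniveau_mono`, `coniveau_zero`.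
* `Literature.BettiHodgeData k` and `BettiHodgeData.HodgeConjectureFor`,
  `BettiHodgeData.GeneralizedHodgeConjectureFor`, `BettiHodgeData.algebraicClasses_le_hodgeClasses`.

## Design notes

* Universe `0` throughout: `ComplexPoints X : Type` forces `k : Type`, and then
  `singularCohomology ℚ ℚ (ComplexPoints X) i : ModuleCat.{0} ℚ` matches
  `PreWeilCohomology.H i : (SchemeOver k)ᵒᵖ ⥤ ModuleCat.{0} ℚ`.
* `bettiCohomology`, `bettiCohomology.map`, `bettiCup`, `bettiOne` are `abbrev`s, so the whole
  G04 API (`singularCohomology_induction_on`, `cupProduct_π_π`, …) applies verbatim.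
* Graded commutativity `Literature.AlgebraicTopology.SingularHomology.cupProduct_gradedComm` (Hatcher, Thm. 3.11) is a named fact (`Prop`)
  upstream and enters `bettiCup_gradedComm` as an explicit hypothesis; `Literature.AlgebraicTopology.SingularHomology.d_cochainCup`,
  `cupProduct_assoc`, `cupProduct_map` and `AlgPoints.continuous_map` are proved upstream.
* Mathlib has neither singular/Betti cohomology of schemes nor the coniveau filtration nor Hodge
  structures (searched `Betti`, `coniveau`, `HodgeStructure`, `singularCohomology`: nothing
  relevant); we use Mathlib's `ModuleCat`, `Order.coheight` (codimension of a point, as in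
  `Literature.Prelude.MotiveAbstract.Cycles`), `Submodule.map`, `LinearMap.ker`, `iSup`.

## References

* J.-P. Serre, *Géométrie algébrique et géométrie analytique*, Ann. Inst. Fourier 6 (1956), §2.
* P. Deligne, *Théorie de Hodge II*, Publ. Math. IHÉS 40 (1971), §§2–3.
* A. Grothendieck, *Hodge's general conjecture is false for trivial reasons*, Topology 8 (1969),
  299–303.
* C. Voisin, *Hodge Theory and Complex Algebraic Geometry I*, CUP 2002, Ch. 7 and §11.3.
* S. Kleiman, *Algebraic cycles and the Weil conjectures* (1968), §1.2.
* P. Deligne, *The Hodge conjecture*, Clay Millennium Problem description (2000).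
-/

universe u

open CategoryTheory AlgebraicGeometry Opposite

noncomputable section

namespace Literature.AlgebraicGeometry.Motives

variable {k : Type} [Field k] [Algebra k ℂ]

/-! ### Betti cohomology -/

/-- The **Betti cohomology** `Hⁱ_B(X) = Hⁱ(X(ℂ); ℚ)` of a scheme `X` over `k ⊆ ℂ`: rational
singular cohomology of the complex points with the analytic topology (Serre, GAGA §2; Deligne,
Hodge II, §3.2; Kleiman 1968, §1.2, Example (1)). An `abbrev` for
`singularCohomology ℚ ℚ (ComplexPoints X) i`. [cite: Kleiman1968, §1.2  Example (1] -/
abbrev bettiCohomology (X : SchemeOver k) (i : ℕ) : ModuleCat.{0} ℚ :=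
  Literature.AlgebraicTopology.SingularHomology.singularCohomology ℚ ℚ (ComplexPoints X) i

namespace bettiCohomology

variable {X Y Z : SchemeOver k}

/-- Pull-back `f* : Hⁱ_B(Y) ⟶ Hⁱ_B(X)` in Betti cohomology along a `k`-morphism `f : X ⟶ Y`,
induced by the continuous map `f(ℂ) : X(ℂ) → Y(ℂ)` (`AlgPoints.mapContinuous`; Serre, GAGA §2;
Hatcher, *Algebraic Topology*, §3.1). [folklore] -/
abbrev map (f : X ⟶ Y) (i : ℕ) : bettiCohomology Y i ⟶ bettiCohomology X i :=
  Literature.AlgebraicTopology.SingularHomology.singularCohomology.map ℚ ℚ (AlgPoints.mapContinuous (L := ℂ) f) i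

/-- `(𝟙 X)(ℂ)` is the identity continuous map. [folklore] -/
lemma _root_.Literature.AlgebraicGeometry.Motives.AlgPoints.mapContinuous_id {L : Type u} [Field L] {k' : Type u} [Field k']
    [Algebra k' L] [TopologicalSpace L] (X : SchemeOver k') :
    AlgPoints.mapContinuous (L := L) (𝟙 X) = ContinuousMap.id _ :=
  ContinuousMap.ext AlgPoints.map_id_apply

/-- `(φ ≫ ψ)(ℂ) = ψ(ℂ) ∘ φ(ℂ)` as continuous maps. [folklore] -/
lemma _root_.Literature.AlgebraicGeometry.Motives.AlgPoints.mapContinuous_comp {L : Type u} [Field L] {k' : Type u} [Field k']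
    [Algebra k' L] [TopologicalSpace L] {X Y Z : SchemeOver k'} (φ : X ⟶ Y) (ψ : Y ⟶ Z) :
    AlgPoints.mapContinuous (L := L) (φ ≫ ψ) =
      (AlgPoints.mapContinuous ψ).comp (AlgPoints.mapContinuous φ) :=
  ContinuousMap.ext (AlgPoints.map_comp_apply φ ψ)

/-- `(𝟙 X)* = 𝟙` on Betti cohomology (Hatcher §3.1). [folklore] -/
@[simp]
lemma map_id (i : ℕ) : map (𝟙 X) i = 𝟙 _ := by
  rw [map, AlgPoints.mapContinuous_id, Literature.AlgebraicTopology.SingularHomology.singularCohomology.map_id]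

/-- `(f ≫ g)* = g* ≫ f*` on Betti cohomology (contravariance; Hatcher §3.1). [folklore] -/
@[reassoc]
lemma map_comp (f : X ⟶ Y) (g : Y ⟶ Z) (i : ℕ) : map (f ≫ g) i = map g i ≫ map f i := by
  rw [map, AlgPoints.mapContinuous_comp, Literature.AlgebraicTopology.SingularHomology.singularCohomology.map_comp]

end bettiCohomology

variable (k) in
/-- The Betti cohomology functor `Hⁱ_B : (Sch/k)ᵒᵖ ⥤ Vect_ℚ`, `X ↦ Hⁱ(X(ℂ); ℚ)`
(Deligne, Hodge II, §3.2; Kleiman 1968, §1.2, Example (1)). [cite: Kleiman1968, §1.2  Example (1] -/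
def bettiFunctor (i : ℕ) : (SchemeOver k)ᵒᵖ ⥤ ModuleCat.{0} ℚ where
  obj X := bettiCohomology X.unop i
  map f := bettiCohomology.map f.unop i
  map_id _ := bettiCohomology.map_id i
  map_comp f g := bettiCohomology.map_comp g.unop f.unop i

/-- `bettiFunctor` on objects is `bettiCohomology`. [folklore] -/
@[simp]
lemma bettiFunctor_obj (i : ℕ) (X : (SchemeOver k)ᵒᵖ) :
    (bettiFunctor k i).obj X = bettiCohomology X.unop i := rfl

/-- `bettiFunctor` on morphisms is `bettiCohomology.map`. [folklore] -/
@[simp]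
lemma bettiFunctor_map (i : ℕ) {X Y : (SchemeOver k)ᵒᵖ} (f : X ⟶ Y) :
    (bettiFunctor k i).map f = bettiCohomology.map f.unop i := rfl

/-! ### Cup product -/

section Cup

variable {X Y : SchemeOver k} {p q n : ℕ}

/-- The cup product `Hᵖ_B(X) →ₗ H^q_B(X) →ₗ Hⁿ_B(X)`, `p + q = n`, on Betti cohomology: G04's
Alexander–Whitney cup product `Literature.AlgebraicTopology.SingularHomology.cupProduct` on `X(ℂ)` (Hatcher, *Algebraic Topology*, §3.2). [folklore] -/
abbrev bettiCup (h : p + q = n) :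
    bettiCohomology X p →ₗ[ℚ] bettiCohomology X q →ₗ[ℚ] bettiCohomology X n :=
  Literature.AlgebraicTopology.SingularHomology.cupProduct h

variable (X) in
/-- The unit `1 ∈ H⁰_B(X)` (Hatcher §3.2, p. 211): G04's `singularCohomology.one`. [folklore] -/
abbrev bettiOne : bettiCohomology X 0 :=
  Literature.AlgebraicTopology.SingularHomology.singularCohomology.one ℚ (ComplexPoints X)

/-- Naturality of the Betti cup product: `f*(a ∪ b) = f*a ∪ f*b` (Hatcher, Prop. 3.10; from
`Literature.AlgebraicTopology.SingularHomology.cupProduct_map`). [folklore] -/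
theorem bettiCup_map (f : X ⟶ Y) (h : p + q = n) (a : bettiCohomology Y p)
    (b : bettiCohomology Y q) :
    bettiCohomology.map f n (bettiCup h a b) =
      bettiCup h (bettiCohomology.map f p a) (bettiCohomology.map f q b) :=
  Literature.AlgebraicTopology.SingularHomology.cupProduct_map _ h a b

/-- Graded commutativity of the Betti cup product: `a ∪ b = (-1)^{pq} b ∪ a` (Hatcher, Thm. 3.11),
relative to the named fact `Literature.cupProduct_gradedComm ℚ X(ℂ)` (graded commutativity of the
singular cup product, vendored upstream as a `Prop`, not proved), taken as the hypothesis `hc`. [folklore] -/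
theorem bettiCup_gradedComm (hc : Literature.AlgebraicTopology.SingularHomology.cupProduct_gradedComm ℚ (ComplexPoints X)) (h : p + q = n)
    (h' : q + p = n) (a : bettiCohomology X p) (b : bettiCohomology X q) :
    bettiCup h a b = ((-1 : ℚ) ^ (p * q)) • bettiCup h' b a :=
  hc h h' a b

/-- Associativity of the Betti cup product (Hatcher §3.2, p. 211; from `Literature.AlgebraicTopology.SingularHomology.cupProduct_assoc`). [folklore] -/
theorem bettiCup_assoc {r m l s : ℕ} (hpq : p + q = m) (hqr : q + r = l) (hm : m + r = s)
    (hl : p + l = s) (a : bettiCohomology X p) (b : bettiCohomology X q)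
    (c : bettiCohomology X r) :
    bettiCup hm (bettiCup hpq a b) c = bettiCup hl a (bettiCup hqr b c) :=
  Literature.AlgebraicTopology.SingularHomology.cupProduct_assoc hpq hqr hm hl a b c

/-- `1 ∪ b = b` in Betti cohomology (Hatcher §3.2, p. 211). [folklore] -/
theorem one_bettiCup (b : bettiCohomology X q) : bettiCup (Nat.zero_add q) (bettiOne X) b = b :=
  Literature.AlgebraicTopology.SingularHomology.one_cupProduct b

/-- `a ∪ 1 = a` in Betti cohomology (Hatcher §3.2, p. 211). [folklore] -/
theorem bettiCup_one (a : bettiCohomology X p) : bettiCup (Nat.add_zero p) a (bettiOne X) = a :=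
  Literature.AlgebraicTopology.SingularHomology.cupProduct_one a

/-- `f* 1 = 1` in Betti cohomology (Hatcher, Prop. 3.10). [folklore] -/
theorem bettiCohomology.map_one (f : X ⟶ Y) : bettiCohomology.map f 0 (bettiOne Y) = bettiOne X :=
  Literature.AlgebraicTopology.SingularHomology.singularCohomology.map_one _

end Cup

/-! ### The coniveau filtration -/

section Coniveau

variable (X : SchemeOver k)

/-- The complex points of the open complement `X ∖ Z` of a subset `Z ⊆ X`, as the subspace
`{P ∈ X(ℂ) | pt P ∉ Z}` of `X(ℂ)` (for `Z` Zariski-closed this is `(X ∖ Z)(ℂ)` with its analytic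
topology; Grothendieck 1969, §1). [cite: Grothendieck1969, §1] -/
abbrev complexPointsCompl (Z : Set X.left) : Type :=
  {P : ComplexPoints X // P.pt ∉ Z}

/-- The restriction map `Hⁱ_B(X) ⟶ Hⁱ((X ∖ Z)(ℂ); ℚ)` to the complement of `Z ⊆ X`
(Grothendieck 1969, §1), induced by the inclusion `(X ∖ Z)(ℂ) ↪ X(ℂ)`. [cite: Grothendieck1969, §1] -/
abbrev bettiCohomology.restrictCompl (Z : Set X.left) (i : ℕ) :
    bettiCohomology X i ⟶ Literature.AlgebraicTopology.SingularHomology.singularCohomology ℚ ℚ (complexPointsCompl X Z) i :=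
  Literature.AlgebraicTopology.SingularHomology.singularCohomology.map ℚ ℚ
    (⟨Subtype.val, continuous_subtype_val⟩ : C(complexPointsCompl X Z, ComplexPoints X)) i

/-- The **coniveau filtration** `Nʳ Hⁱ_B(X) ⊆ Hⁱ_B(X)` (Grothendieck, *Hodge's general conjecture
is false for trivial reasons*, Topology 8 (1969), §1; Bloch–Ogus 1974): the subspace spanned by
the classes whose restriction to `(X ∖ Z)(ℂ)` vanishes for some Zariski-closed `Z ⊆ X` of
codimension `≥ r`. "Codimension `≥ r`" is phrased pointwise, `r ≤ Order.coheight z` for every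
`z ∈ Z` (equivalent to the condition on the generic points of the irreducible components of `Z`,
since `coheight` is antitone under specialisation); `Order.coheight` is Mathlib's codimension of a
scheme point, as in `Literature.Prelude.MotiveAbstract.Cycles`. [cite: BlochOgus1974] -/
def coniveau (i r : ℕ) : Submodule ℚ (bettiCohomology X i) :=
  ⨆ (Z : Set X.left) (_ : IsClosed Z) (_ : ∀ z ∈ Z, (r : ℕ∞) ≤ Order.coheight z),
    LinearMap.ker (bettiCohomology.restrictCompl X Z i).hom

variable {X}

/-- The singular cohomology of the empty space vanishes in every degree (there are no singular
simplices, so every cochain module is `0`; Hatcher §3.1). A small addition to the G04 API used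
for `coniveau_zero`. [folklore] -/
theorem isZero_singularCohomology_of_isEmpty (R : Type u) [CommRing R] (M : Type u)
    [AddCommGroup M] [Module R M] {E : Type u} [TopologicalSpace E] [IsEmpty E] (n : ℕ) :
    Limits.IsZero (Literature.AlgebraicTopology.SingularHomology.singularCohomology R M E n) := by
  haveI : IsEmpty (Literature.AlgebraicTopology.SingularHomology.SingularSimplex E n) :=
    haveI : IsEmpty C(stdSimplex ℝ (Fin (n + 1)), E) :=
      ⟨fun f ↦ isEmptyElim (f (Classical.arbitrary _))⟩
    Literature.AlgebraicTopology.SingularHomology.SingularSimplex.toContinuousMap.isEmpty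
  haveI hs : Subsingleton ((Literature.AlgebraicTopology.SingularHomology.singularCochainComplex R M E).X n) :=
    ⟨fun φ ψ ↦ Literature.AlgebraicTopology.SingularHomology.singularCochainComplex.ext fun σ ↦ isEmptyElim σ⟩
  exact ShortComplex.isZero_homology_of_isZero_X₂ _
    (@ModuleCat.isZero_of_subsingleton _ _ ((Literature.AlgebraicTopology.SingularHomology.singularCochainComplex R M E).X n) hs)

/-- A class killed by restriction to the complement of a closed `Z` of codimension `≥ r` lies in
`Nʳ Hⁱ_B(X)` (Grothendieck 1969, §1: the defining generators). [cite: Grothendieck1969, §1: the defining generators] -/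
theorem mem_coniveau_of_restrictCompl_eq_zero {i r : ℕ} {Z : Set X.left} (hZ : IsClosed Z)
    (hr : ∀ z ∈ Z, (r : ℕ∞) ≤ Order.coheight z) {x : bettiCohomology X i}
    (hx : bettiCohomology.restrictCompl X Z i x = 0) : x ∈ coniveau X i r := by
  refine Submodule.mem_iSup_of_mem Z (Submodule.mem_iSup_of_mem hZ
    (Submodule.mem_iSup_of_mem hr ?_))
  exact hx

variable (X) in
/-- The coniveau filtration is decreasing in `r`: `Nˢ Hⁱ ⊆ Nʳ Hⁱ` for `r ≤ s`
(Grothendieck 1969, §1). [cite: Grothendieck1969, §1] -/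
theorem coniveau_mono (i : ℕ) {r s : ℕ} (h : r ≤ s) : coniveau X i s ≤ coniveau X i r := by
  refine iSup_mono fun Z ↦ iSup_mono fun _ ↦ ?_
  refine iSup_le fun hs ↦ le_iSup_of_le (fun z hz ↦ le_trans ?_ (hs z hz)) le_rfl
  exact_mod_cast h

variable (X) in
/-- The coniveau filtration is an antitone function of `r` (Grothendieck 1969, §1). [cite: Grothendieck1969, §1] -/
theorem antitone_coniveau (i : ℕ) : Antitone (coniveau X i) :=
  fun _ _ h ↦ coniveau_mono X i h

variable (X) in
/-- `N⁰ Hⁱ_B(X) = Hⁱ_B(X)`: take `Z = X`, whose complement has no complex points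
(Grothendieck 1969, §1). [cite: Grothendieck1969, §1] -/
theorem coniveau_zero (i : ℕ) : coniveau X i 0 = ⊤ := by
  refine eq_top_iff.2 fun x _ ↦ mem_coniveau_of_restrictCompl_eq_zero isClosed_univ
    (fun _ _ ↦ by simp) ?_
  haveI : IsEmpty (complexPointsCompl X Set.univ) := ⟨fun P ↦ P.2 (Set.mem_univ _)⟩
  haveI := ModuleCat.subsingleton_of_isZero
    (isZero_singularCohomology_of_isEmpty ℚ ℚ (E := complexPointsCompl X Set.univ) i)
  exact Subsingleton.elim _ _

end Coniveau

/-! ### The Betti–Hodge realization data -/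

/-- **Betti–Hodge realization data** over a subfield `k ⊆ ℂ`: a hypothesis structure standing in
for the theorem that Betti cohomology of smooth projective `k`-varieties is a Weil cohomology
theory whose groups carry functorial, polarizable pure `ℚ`-Hodge structures with algebraic
classes of Hodge type `(p, p)` (Hodge decomposition and Lefschetz theorems: Voisin, *Hodge Theory
I*, Thm. 6.19, §7.1, Thm. 6.32; cycle class: Voisin I, §11.3, Prop. 11.20; Deligne, Hodge II,
§3.2; Kleiman 1968, §1.2, Example (1)). It consists of a Weil cohomology theory `W` with
coefficients `ℚ`, a natural isomorphism `W.H i ≅ bettiFunctor k i` compatible with cup products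
and units, and, for smooth projective `X`, a Hodge structure of weight `i` on each `Hⁱ(X)` such
that pull-backs are morphisms of Hodge structures, each `Hⁱ(X)` is polarizable (untwisted
convention of `HodgeStructure.Polarization`, Voisin I §7.1.2), and cycle classes are Hodge
classes. Only `Prop`-valued conjectures are stated against it (outline §1(f)). [cite: Kleiman1968, §1.2  Example (1] -/
structure BettiHodgeData (k : Type) [Field k] [Algebra k ℂ] where
  /-- The underlying Weil cohomology theory with `ℚ`-coefficients (trace, cycle classes, axioms). -/
  W : WeilCohomology k ℚ
  /-- The identification `Hⁱ(X) ≅ Hⁱ(X(ℂ); ℚ)` with Betti cohomology, natural in `X`. -/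
  iso (i : ℕ) : W.H i ≅ bettiFunctor k i
  /-- `iso` is multiplicative: it carries `W.cup` to the singular cup product `bettiCup`. -/
  iso_cup : ∀ (X : SchemeOver k) ⦃p q n : ℕ⦄ (h : p + q = n) (a : W.obj X p) (b : W.obj X q),
    ((iso n).hom.app (op X)).hom (W.cup h a b) =
      bettiCup h (((iso p).hom.app (op X)).hom a) (((iso q).hom.app (op X)).hom b)
  /-- `iso` carries the unit `W.one X` to `1 ∈ H⁰(X(ℂ); ℚ)`. -/
  iso_one : ∀ X : SchemeOver k, ((iso 0).hom.app (op X)).hom (W.one X) = bettiOne X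
  /-- The pure `ℚ`-Hodge structure of weight `i` on `Hⁱ(X)`, `X` smooth projective
  (Hodge decomposition; Voisin I, Thm. 6.19 and §7.1.1). -/
  hodge : ∀ ⦃n : ℕ⦄ ⦃X : SchemeOver k⦄, IsSmoothProjective n X → ∀ i : ℕ,
    HodgeStructure (W.obj X i) (i : ℤ)
  /-- Pull-back along a morphism of smooth projective varieties is a morphism of Hodge
  structures (Voisin I, §7.3.2). -/
  pullback_hom : ∀ ⦃n : ℕ⦄ ⦃X : SchemeOver k⦄ (hX : IsSmoothProjective n X)
    ⦃m : ℕ⦄ ⦃Y : SchemeOver k⦄ (hY : IsSmoothProjective m Y) (f : X ⟶ Y) (i : ℕ),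
    ∃ φ : HodgeStructure.Hom (hodge hY i) (hodge hX i), φ.toLinearMap = W.pullback f i
  /-- Each `Hⁱ(X)`, `X` smooth projective, is a polarizable Hodge structure (Hodge–Riemann
  bilinear relations and Lefschetz decomposition; Voisin I, Thm. 6.32 and §7.1.2), in the
  untwisted sign convention of `HodgeStructure.Polarization`. -/
  polarizable : ∀ ⦃n : ℕ⦄ ⦃X : SchemeOver k⦄ (hX : IsSmoothProjective n X) (i : ℕ),
    (hodge hX i).IsPolarizable
  /-- The class of a prime cycle of codimension `p` is a Hodge class in `H²ᵖ(X)`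
  (Voisin I, Prop. 11.20). -/
  cycleClass_mem_hodgeClasses : ∀ ⦃n : ℕ⦄ ⦃X : SchemeOver k⦄ (hX : IsSmoothProjective n X)
    (p : ℕ) (z : X.left), Order.coheight z = p →
      W.cycleClass X p z ∈ (hodge hX (2 * p)).hodgeClasses p

namespace BettiHodgeData

variable (B : BettiHodgeData k) {n : ℕ} {X : SchemeOver k}

/-- The comparison isomorphism `Hⁱ(X) ≃ₗ[ℚ] Hⁱ(X(ℂ); ℚ)` of a Betti–Hodge realization datum at
`X`, as a linear equivalence (component of `B.iso i` at `X`). [folklore] -/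
def isoObj (X : SchemeOver k) (i : ℕ) : B.W.obj X i ≃ₗ[ℚ] bettiCohomology X i :=
  ((B.iso i).app (op X)).toLinearEquiv

/-- `B.isoObj X i` is the component of `B.iso i` at `X`. [folklore] -/
@[simp]
lemma isoObj_apply (X : SchemeOver k) (i : ℕ) (a : B.W.obj X i) :
    B.isoObj X i a = ((B.iso i).hom.app (op X)).hom a := rfl

/-- Naturality of the comparison: `iso (f* a) = f(ℂ)* (iso a)`. [folklore] -/
lemma isoObj_pullback {Y : SchemeOver k} (f : X ⟶ Y) (i : ℕ) (a : B.W.obj Y i) :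
    B.isoObj X i (B.W.pullback f i a) = bettiCohomology.map f i (B.isoObj Y i a) := by
  have h := congrArg (fun g ↦ g.hom a) ((B.iso i).hom.naturality f.op)
  simp only [ModuleCat.hom_comp, LinearMap.comp_apply] at h
  exact h

/-- Algebraic classes are Hodge classes: `ℚ · Aᵖ(X) ⊆ Hdgᵖ(X) = H²ᵖ(X, ℚ) ∩ Hᵖ,ᵖ` (Voisin I,
Prop. 11.20; the easy inclusion of the Hodge conjecture). [folklore] -/
theorem algebraicClasses_le_hodgeClasses (hX : IsSmoothProjective n X) (p : ℕ) :
    B.W.algebraicClasses X p ≤ (B.hodge hX (2 * p)).hodgeClasses p := by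
  refine Submodule.span_le.2 ?_
  change B.W.algebraicLattice X p ≤ ((B.hodge hX (2 * p)).hodgeClasses p).toAddSubgroup
  refine (AddSubgroup.closure_le _).2 ?_
  rintro _ ⟨z, rfl⟩
  exact B.cycleClass_mem_hodgeClasses hX p z z.2

/-- The **Hodge conjecture** for a smooth projective `X` in codimension `p`, relative to the
Betti–Hodge realization data `B`: every rational Hodge class in `H²ᵖ(X, ℚ)` is a `ℚ`-linear
combination of classes of algebraic cycles, i.e. `ℚ · Aᵖ(X) = Hdgᵖ(X)` (Hodge 1950; Deligne,
*The Hodge conjecture*, Clay 2000; Voisin I, Conj. 11.24). The inclusion `⊆` is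
`algebraicClasses_le_hodgeClasses`. A `Prop`-valued definition (open problem). [cite: Hodge1950] -/
def HodgeConjectureFor (hX : IsSmoothProjective n X) (p : ℕ) : Prop :=
  B.W.algebraicClasses X p = (B.hodge hX (2 * p)).hodgeClasses p

/-- The Hodge conjecture for `(X, p)` is equivalent to the inclusion `Hdgᵖ(X) ⊆ ℚ · Aᵖ(X)`. [folklore] -/
theorem hodgeConjectureFor_iff (hX : IsSmoothProjective n X) (p : ℕ) :
    B.HodgeConjectureFor hX p ↔
      (B.hodge hX (2 * p)).hodgeClasses p ≤ B.W.algebraicClasses X p :=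
  ⟨fun h ↦ h.ge, fun h ↦ le_antisymm (B.algebraicClasses_le_hodgeClasses hX p) h⟩

/-- Grothendieck's **generalized Hodge conjecture** for a smooth projective `X`, degree `i` and
coniveau `r`, relative to `B`: every sub-`ℚ`-Hodge structure `S ⊆ Hⁱ(X, ℚ)` of level
`≤ i - 2r` (i.e. `S_ℂ ⊆ F^r ⊕ … ⊕ conj F^r`) is supported in codimension `r`, i.e. its image in
`Hⁱ(X(ℂ); ℚ)` lies in the coniveau filtration `Nʳ Hⁱ_B(X)` (Grothendieck, Topology 8 (1969),
pp. 300–301, the corrected form of Hodge's "general conjecture"). Only the image under the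
comparison `B.iso` is used, so the statement lives in `Hⁱ(X(ℂ); ℚ)` where `coniveau` is defined.
A `Prop`-valued definition (open problem). [folklore] -/
def GeneralizedHodgeConjectureFor (hX : IsSmoothProjective n X) (i r : ℕ) : Prop :=
  ∀ S : HodgeStructure.SubHodgeStructure (B.hodge hX i), S.level + 2 * r ≤ i →
    S.toSubmodule.map ((B.iso i).hom.app (op X)).hom ≤ coniveau X i r

end BettiHodgeData

end Literature.AlgebraicGeometry.Motives

end
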